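import Mathlib
import Summits.ValiantsHypothesis.ValiantsHypothesis.Theses.LiouvilleSarnak

/-!
# Crux `LiouvilleSarnak.AlignedTypeI` (stmt-ValiantsHypothesis-21040) — line `characters_mod_2n`

Skeleton line (crux-plan, planner `val-width-lines-2`, 2026-08-27).  The crux (T5b rung of the held milestone
`DigitalBilinearLiouville`): `Σ_{a<2^n} |Σ_{b<2^n} λ(a + 1 + 2^n b)| = o(4^n)` — Liouville has `o(1)` cancellation in
`ℓ¹`-average over the residue classes of the ALIGNED modulus `q = 2^n = √x`.  KNOWN modulo two theorems in print
(refuter `parity-tllh-ref-1` g2 concurs); this skeleton is the standard route through Dirichlet characters modulo powers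
of two:

* `stub_kmtVariance` — Klurman–Mangerel–Teräväinen, Proc. LMS 127 (2023), Thm 1.3 (SMOOTH moduli, no exceptional set),
  specialised to `f = λ`, `q = Q = 2^k`, `x = 2^{n+k}`, `k₀(ε) ≤ k ≤ n`: the variance of `λ` over the odd classes
  `u (mod 2^k)` along `b < 2^n`, around the main term carried by ONE character `χ (mod 2^k)`, is `≤ ε 2^k 4^n`
  (`2^k` is `q^{ε'}`-smooth once `k ≥ exp(ε^{-4})`, and `(x/Q)^{ε²} = 2^{nε²}`-typical once `2^{nε²} ≥ 541`).
* `stub_twistedLiouvilleSmall` — `|Σ_{m ≤ 2^{n+k}} λ(m) χ(m)| ≤ ε 2^{n+k}` uniformly in `k ≤ n` and `χ (mod 2^k)`: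
  Banks–Shparlinski, TAMS (2019), Thm 2.2 (Möbius sums twisted by characters to the powerful modulus `2^γ`, `γ ≥ γ₀`,
  saving uniform in the three ranges of `x` versus `q`) + the remark after it (imprimitive characters mod `2^γ`) +
  Siegel–Walfisz / PNT in progressions for the finitely many conductors `< 2^{γ₀}` + the convolution `λ = 1_□ * μ`.
* `stub_assembly` (PROVABLE NOW, L-sized bookkeeping): even classes `a + 1 = 2^v u` reduce to modulus `2^{n-v}` by
  `λ(2^v y) = (-1)^v λ(y)` (tree `Theorems.LiouvilleSarnakAligned.liouville_two_pow_mul`); for `k = n - v ≥ k₀`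
  Cauchy–Schwarz on the variance plus the main terms bounded by stub 2 give `√ε·2^{k-1}·2^n + ε 2^{n+k}`, summing over
  `k ≤ n` to `O(√ε) 4^n`; for `k < k₀` orthogonality of characters and stub 2 give `ε 2^{n+2k₀}`; `a + 1 = 2^n` is PNT.
* `AlignedTypeI_of`: composition (kernel-checked).
-/

set_option linter.dupNamespace false

namespace Summit.ValiantsHypothesis.ValiantsHypothesis.Cruxes.AlignedTypeI.CharactersModTwoN

open Summit.ValiantsHypothesis.ValiantsHypothesis.Theses.LiouvilleSarnak

/-- KMT-type variance statement for `λ` to the moduli `2^k`, `k₀ ≤ k ≤ n`, progressions of length `2^n`. -/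
def KMTVariance : Prop :=
  ∀ ε : ℝ, 0 < ε → ∃ k₀ n₀ : ℕ, ∀ n ≥ n₀, ∀ k : ℕ, k₀ ≤ k → k ≤ n →
    ∃ χ : DirichletCharacter ℂ (2 ^ k),
      ∑ u : (ZMod (2 ^ k))ˣ,
        ‖(∑ b : Fin (2 ^ n), ((ArithmeticFunction.liouville ((u : ZMod (2 ^ k)).val + 2 ^ k * (b : ℕ)) : ℤ) : ℂ))
          - χ (u : ZMod (2 ^ k)) / (Nat.totient (2 ^ k) : ℂ) *
            ∑ m : Fin (2 ^ (n + k)), ((ArithmeticFunction.liouville ((m : ℕ) + 1) : ℤ) : ℂ) *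
              star (χ (((m : ℕ) + 1 : ℕ) : ZMod (2 ^ k)))‖ ^ 2
        ≤ ε * 2 ^ k * 4 ^ n

/-- Twisted Liouville sums to moduli `2^k`, `k ≤ n`, over `[1, 2^{n+k}]` are `o(2^{n+k})` uniformly. -/
def TwistedLiouvilleSmall : Prop :=
  ∀ ε : ℝ, 0 < ε → ∃ n₀ : ℕ, ∀ n ≥ n₀, ∀ k ≤ n, ∀ χ : DirichletCharacter ℂ (2 ^ k),
    ‖∑ m : Fin (2 ^ (n + k)), ((ArithmeticFunction.liouville ((m : ℕ) + 1) : ℤ) : ℂ) *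
        χ (((m : ℕ) + 1 : ℕ) : ZMod (2 ^ k))‖ ≤ ε * 2 ^ (n + k)

/-- **Stub 1 (cite-grade)** — Klurman–Mangerel–Teräväinen 2023, Thm 1.3, for `f = λ`, `q = Q = 2^k`, `x = 2^{n+k}`.
[cite: arXiv:1909.12280, Thm. 1.3] -/
theorem stub_kmtVariance : KMTVariance := by
  sorry

/-- **Stub 2 (cite-grade + classical glue)** — Banks–Shparlinski 2019, Thm 2.2 and the remark following it, with
Siegel–Walfisz for bounded conductors and `λ = 1_□ * μ`. [cite: arXiv:1801.10276, Thm. 2.2] -/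
theorem stub_twistedLiouvilleSmall : TwistedLiouvilleSmall := by
  sorry

/-- The assembly glue as a named proposition: the two cite-grade inputs imply the rung. -/
def KMTBSImpliesAligned : Prop :=
  KMTVariance → TwistedLiouvilleSmall → AlignedTypeI

/-- **Stub 3 (provable now, L)** — the assembly: dyadic split of the classes `a + 1 = 2^v u` (`liouville_two_pow_mul`),
Cauchy–Schwarz on the variance for `n - v ≥ k₀`, orthogonality of characters for `n - v < k₀`, main terms and the
class `a + 1 = 2^n` by stub 2. [folklore] -/
theorem stub_assembly : KMTBSImpliesAligned := by
  sorry

/-- **Composition (kernel-checked).** [folklore] -/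
theorem AlignedTypeI_of : AlignedTypeI := by
  have h : KMTVariance → TwistedLiouvilleSmall → AlignedTypeI := stub_assembly
  exact h stub_kmtVariance stub_twistedLiouvilleSmall

end Summit.ValiantsHypothesis.ValiantsHypothesis.Cruxes.AlignedTypeI.CharactersModTwoN
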